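import Summits.ABC.ABC.Theses.IneffectiveSubspace
import Summits.ABC.ABC.Theorems.UniformSadicTowerFour.Negative.SLossFloor
import Summits.ABC.ABC.Theorems.IneffectiveSubspaceUniformSadicTowerFourQuarticRootWall

/-!
# The Pell-square cell with `S` excused: `1 + t² = s·m·n⁴`, `s` an `S`-unit (stmt-ABC-14937)

The `K ≥ 1` reading of the Pell-square cell of line `SketchIdeator4` (card
`Cruxes/UniformSadicTowerFour/Ideas/gaussian-thue-pell-square.md`, §Transfer C⁺: "with `S` excused,
`1 + t² = (S-unit)·m·n⁴` and the crux reads … — the Thue–Mahler version of the harmonic family with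
LINEAR `S`-loss") for crux #2 `UniformSadicTowerFour` of route `IneffectiveSubspace`.

The crux bounds `c = ∏ zᵢ^(i+1)` of a positive coprime level-4 tower point by
`C(K,ε)·((∏_{p∈S} p)·{M}^S)^(1+ε)`, `M = ∏ xᵢyᵢzᵢ`, `{M}^S` the `S`-free part of `M`, uniformly over
prime sets `S` of size `≤ K`.  At the tower point `x = (1,1,1,1)`, `y = (1,t,1,1)`,
`z = (s·m,1,1,n)` with `s` an `S`-unit (`s.primeFactors ⊆ S`) one has `c = s·m·n⁴`,
`M = s·(t·m·n)` and `{M}^S ∣ t·m·n` (`Negative.sfree_dvd`), whence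

* `cellRawS_of_uniformSadicTowerFour` — crux ⟹ `s·m·n⁴ < C(K,ε)·((∏_{p∈S} p)·t·m·n)^(1+ε)`
  (the registered stub of the line; at `K = 0`, `s = 1` it is
  `QuarticRootWall.cellRaw_of_uniformSadicTowerFour`);
* `pellSquareCellS_of_cellRawS`, `pellSquareCellS_of_uniformSadicTowerFour` — "`W₄` with `K` excused
  places": `n ≤ C(K,ε)·(∏_{p∈S} p)^(1+ε)·m^(1/2+ε)` (square, use `t² < s·m·n⁴`, drop `s^(1−δ) ≥ 1`).

Uses only Mathlib, the landed `Negative.sfree_dvd` (S-loss floor file) and the landed real-exponent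
bookkeeping lemma `QuarticRootWall.lt_rpow_mul_rpow_of_rpow_lt`.
-/

-- `Summit.<Summit>.<Problem>` is the mandated summit-side namespace (CONVENTIONS §2); for the
-- single-conjunct summit `ABC` the two coincide, so the duplicate `ABC.ABC` is deliberate.
set_option linter.dupNamespace false
namespace Summit.ABC.ABC.Theorems.UniformSadicTowerFour.QuarticRootWall

open scoped BigOperators
open Summit.ABC.ABC.Theses.IneffectiveSubspace
open Summit.ABC.ABC.Theorems

/-! ## The cell inequality with `S` excused -/

/-- **The crux implies `CellRawS`** (the `K ≥ 1` reading of the Pell-square cell). If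
`1 + t² = s·m·n⁴` with `t, s, m, n > 0` and every prime factor of `s` in `S` (`|S| ≤ K`, primes),
then `s·m·n⁴ < C(K,ε)·((∏_{p∈S} p)·t·m·n)^(1+ε)`: apply `UniformSadicTowerFour` to the tower point
`x = (1,1,1,1)`, `y = (1,t,1,1)`, `z = (s·m,1,1,n)` (`gcd(1,t²) = 1`), where `∏ zᵢ^(i+1) = s·m·n⁴`,
`M = ∏ xᵢyᵢzᵢ = s·(t·m·n)`, and bound the `S`-free part `{M}^S ∣ t·m·n` (`Negative.sfree_dvd`).
(Card §Transfer C⁺.) [folklore] -/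
theorem cellRawS_of_uniformSadicTowerFour (hU : UniformSadicTowerFour) :
    ∀ K : ℕ, ∀ ε : ℝ, 0 < ε → ∃ C : ℝ, 0 < C ∧ ∀ S : Finset ℕ, S.card ≤ K → (∀ p ∈ S, Nat.Prime p) →
      ∀ t s m n : ℕ, 0 < t → 0 < s → 0 < m → 0 < n → s.primeFactors ⊆ S →
      1 + t ^ 2 = s * m * n ^ 4 →
      ((s * m * n ^ 4 : ℕ) : ℝ) < C * (((∏ p ∈ S, p) * (t * m * n) : ℕ) : ℝ) ^ (1 + ε) := by
  intro K ε hε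
  obtain ⟨C, hC, hK⟩ := hU K ε hε
  refine ⟨C, hC, fun S hS hSp t s m n ht hs hm hn hsub hcell => ?_⟩
  have hsm : 0 < s * m := Nat.mul_pos hs hm
  have key := hK S hS hSp ![1, 1, 1, 1] ![1, t, 1, 1] ![s * m, 1, 1, n]
    (by intro i; fin_cases i <;> simp [hsm, ht, hn]) (by simpa [Fin.prod_univ_four] using hcell)
    (by simp [Fin.prod_univ_four])
  have h1 : (∏ i : Fin 4, (![s * m, 1, 1, n] : Fin 4 → ℕ) i ^ (i.val + 1)) = s * m * n ^ 4 := by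
    simp [Fin.prod_univ_four]
  have h2 : (∏ i : Fin 4, (![1, 1, 1, 1] : Fin 4 → ℕ) i * (![1, t, 1, 1] : Fin 4 → ℕ) i *
      (![s * m, 1, 1, n] : Fin 4 → ℕ) i) = s * (t * m * n) := by
    simp [Fin.prod_univ_four, mul_comm, mul_left_comm]
  rw [h1, h2] at key
  have htmn : t * m * n ≠ 0 := by positivity
  have hle : (∏ p ∈ S, p) *
      (∏ r ∈ (s * (t * m * n)).primeFactors \ S, r ^ (s * (t * m * n)).factorization r) ≤
      (∏ p ∈ S, p) * (t * m * n) :=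
    Nat.mul_le_mul_left _
      (Nat.le_of_dvd (Nat.pos_of_ne_zero htmn) (Negative.sfree_dvd hs.ne' htmn hsub))
  exact lt_of_lt_of_le key (mul_le_mul_of_nonneg_left
    (Real.rpow_le_rpow (by positivity) (by exact_mod_cast hle) (by linarith)) hC.le)

/-! ## `CellRawS ⟹ PellSquareCellS`: the quartic-root wall with `K` excused places -/

/-- **`CellRawS` implies `PellSquareCellS`.** From `s·m·n⁴ < C·(P·t·m·n)^(1+δ)` (`P = ∏_{p∈S} p`)
and `t² < s·m·n⁴` one gets `(s·m·n⁴)² < C²·(P²·s·m³·n⁶)^(1+δ)`, i.e.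
`s^(1−δ)·n^(2−6δ) < C²·P^(2+2δ)·m^(1+3δ)`; dropping `s^(1−δ) ≥ 1` (here: `s^(1+δ) ≤ s²`) and taking
`δ := min ε 1 / 8` gives `n ≤ (max C 1)²·P^(1+ε)·m^(1/2+ε)`.  (Card §Transfer C⁺, "`W₄` with `K`
free `p`-adic digits": after discarding the `S`-part `s` of the cofactor,
`n ≤ C(K,ε)·P^(1+ε)·m^(1/2+ε)`.) [folklore] -/
theorem pellSquareCellS_of_cellRawS
    (hR : ∀ K : ℕ, ∀ ε : ℝ, 0 < ε → ∃ C : ℝ, 0 < C ∧ ∀ S : Finset ℕ, S.card ≤ K →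
      (∀ p ∈ S, Nat.Prime p) → ∀ t s m n : ℕ, 0 < t → 0 < s → 0 < m → 0 < n →
      s.primeFactors ⊆ S → 1 + t ^ 2 = s * m * n ^ 4 →
      ((s * m * n ^ 4 : ℕ) : ℝ) < C * (((∏ p ∈ S, p) * (t * m * n) : ℕ) : ℝ) ^ (1 + ε)) :
    ∀ K : ℕ, ∀ ε : ℝ, 0 < ε → ∃ C : ℝ, 0 < C ∧ ∀ S : Finset ℕ, S.card ≤ K →
      (∀ p ∈ S, Nat.Prime p) → ∀ t s m n : ℕ, 0 < t → 0 < s → 0 < m → 0 < n →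
      s.primeFactors ⊆ S → 1 + t ^ 2 = s * m * n ^ 4 →
      (n : ℝ) ≤ C * (((∏ p ∈ S, p) : ℕ) : ℝ) ^ (1 + ε) * (m : ℝ) ^ ((1 : ℝ) / 2 + ε) := by
  intro K ε hε
  set δ : ℝ := min ε 1 / 8 with hδdef
  have hδ0 : 0 < δ := by have := lt_min hε one_pos; positivity
  have hδ1 : δ ≤ 1 / 8 := by have := min_le_right ε 1; rw [hδdef]; linarith
  -- the key exponent inequality: `(2+2δ)/(2−6δ) ≤ 1 + ε` (and hence `(1+3δ)/(2−6δ) ≤ 1/2 + ε`)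
  have hδε : δ * (8 + 6 * ε) ≤ 2 * ε := by
    rcases le_or_gt ε 1 with h | h
    · rw [hδdef, min_eq_left h]; nlinarith
    · rw [hδdef, min_eq_right h.le]; nlinarith
  obtain ⟨C, hC, hCR⟩ := hR K δ hδ0
  refine ⟨max C 1 ^ 2, by positivity, fun S hS hSp t s m n ht hs hm hn hsub hcell => ?_⟩
  have key := hCR S hS hSp t s m n ht hs hm hn hsub hcell
  set P : ℕ := ∏ p ∈ S, p with hPdef
  have hP0 : 0 < P := by rw [hPdef]; exact Finset.prod_pos fun p hp => (hSp p hp).pos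
  have hP1 : (1 : ℝ) ≤ P := by exact_mod_cast hP0
  have hS1 : (1 : ℝ) ≤ s := by exact_mod_cast hs
  have hM1 : (1 : ℝ) ≤ m := by exact_mod_cast hm
  have hPr0 : (0 : ℝ) < P := by positivity
  have hS0 : (0 : ℝ) < s := by positivity
  have hM0 : (0 : ℝ) < m := by positivity
  have hN0 : (0 : ℝ) < n := by exact_mod_cast hn
  have hC1 : (1 : ℝ) ≤ max C 1 := le_max_right _ _
  push_cast at key
  have hδ1' : 0 < 1 + δ := by linarith
  -- `(t m n)² < s m³ n⁶`
  have ht2 : ((t : ℝ) * m * n) ^ 2 < (s : ℝ) * (m : ℝ) ^ 3 * (n : ℝ) ^ 6 := by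
    have h' : (t * m * n) ^ 2 < s * m ^ 3 * n ^ 6 := by
      have h5 : t ^ 2 < s * m * n ^ 4 := by omega
      calc (t * m * n) ^ 2 = t ^ 2 * (m ^ 2 * n ^ 2) := by ring
        _ < s * m * n ^ 4 * (m ^ 2 * n ^ 2) := mul_lt_mul_of_pos_right h5 (by positivity)
        _ = s * m ^ 3 * n ^ 6 := by ring
    exact_mod_cast h'
  -- square: `(s m n⁴)² < C²·((P·t m n)²)^(1+δ) < C²·(P²·s m³ n⁶)^(1+δ)`
  have hsq : ((s : ℝ) * m * (n : ℝ) ^ 4) ^ 2 <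
      C ^ 2 * ((P : ℝ) ^ 2 * ((s : ℝ) * (m : ℝ) ^ 3 * (n : ℝ) ^ 6)) ^ (1 + δ) := by
    have h0 : (0 : ℝ) ≤ (s : ℝ) * m * (n : ℝ) ^ 4 := by positivity
    calc ((s : ℝ) * m * (n : ℝ) ^ 4) ^ 2 < (C * ((P : ℝ) * ((t : ℝ) * m * n)) ^ (1 + δ)) ^ 2 := by
          gcongr
      _ = C ^ 2 * (((P : ℝ) ^ 2 * ((t : ℝ) * m * n) ^ 2) ^ (1 + δ)) := by
          rw [mul_pow, ← Real.rpow_natCast (((P : ℝ) * ((t : ℝ) * m * n)) ^ (1 + δ)) 2,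
            ← Real.rpow_mul (by positivity), mul_comm (1 + δ), Real.rpow_mul (by positivity),
            Real.rpow_natCast, mul_pow]
      _ < C ^ 2 * ((P : ℝ) ^ 2 * ((s : ℝ) * (m : ℝ) ^ 3 * (n : ℝ) ^ 6)) ^ (1 + δ) := by
          gcongr
  -- rewrite both sides as products of real powers
  have hL : ((s : ℝ) * m * (n : ℝ) ^ 4) ^ 2 =
      ((s : ℝ) ^ (2 : ℝ) * (m : ℝ) ^ (2 : ℝ)) *
        ((n : ℝ) ^ (2 - 6 * δ) * (n : ℝ) ^ (6 + 6 * δ)) := by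
    rw [← Real.rpow_add hN0, show (2 - 6 * δ) + (6 + 6 * δ) = ((8 : ℕ) : ℝ) by push_cast; ring,
      Real.rpow_natCast, Real.rpow_two, Real.rpow_two]; ring
  have hRt : ((P : ℝ) ^ 2 * ((s : ℝ) * (m : ℝ) ^ 3 * (n : ℝ) ^ 6)) ^ (1 + δ) =
      (P : ℝ) ^ (2 + 2 * δ) * (s : ℝ) ^ (1 + δ) * ((m : ℝ) ^ (2 : ℝ) * (m : ℝ) ^ (1 + 3 * δ)) *
        (n : ℝ) ^ (6 + 6 * δ) := by
    rw [Real.mul_rpow (by positivity) (by positivity),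
      Real.mul_rpow (by positivity) (by positivity),
      Real.mul_rpow (by positivity) (by positivity), ← Real.rpow_add hM0,
      ← Real.rpow_natCast (P : ℝ) 2, ← Real.rpow_natCast (m : ℝ) 3, ← Real.rpow_natCast (n : ℝ) 6,
      ← Real.rpow_mul hPr0.le, ← Real.rpow_mul hM0.le, ← Real.rpow_mul hN0.le,
      show ((2 : ℕ) : ℝ) * (1 + δ) = 2 + 2 * δ by push_cast; ring,
      show ((3 : ℕ) : ℝ) * (1 + δ) = 2 + (1 + 3 * δ) by push_cast; ring,
      show ((6 : ℕ) : ℝ) * (1 + δ) = 6 + 6 * δ by push_cast; ring]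
    ring
  rw [hL, hRt] at hsq
  -- drop `s`: `s^(1+δ) ≤ s²`, then cancel `s²·m²` and `n^(6+6δ)`
  have hs2 : (s : ℝ) ^ (1 + δ) ≤ (s : ℝ) ^ (2 : ℝ) :=
    Real.rpow_le_rpow_of_exponent_le hS1 (by linarith)
  have hpos1 : (0 : ℝ) < (s : ℝ) ^ (2 : ℝ) * (m : ℝ) ^ (2 : ℝ) := by positivity
  have hpos2 : (0 : ℝ) < (n : ℝ) ^ (6 + 6 * δ) := by positivity
  have hred : (n : ℝ) ^ (2 - 6 * δ) < C ^ 2 * (P : ℝ) ^ (2 + 2 * δ) * (m : ℝ) ^ (1 + 3 * δ) := by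
    have h' : (s : ℝ) ^ (2 : ℝ) * (m : ℝ) ^ (2 : ℝ) *
          ((n : ℝ) ^ (2 - 6 * δ) * (n : ℝ) ^ (6 + 6 * δ)) <
        (s : ℝ) ^ (2 : ℝ) * (m : ℝ) ^ (2 : ℝ) *
          ((C ^ 2 * (P : ℝ) ^ (2 + 2 * δ) * (m : ℝ) ^ (1 + 3 * δ)) * (n : ℝ) ^ (6 + 6 * δ)) :=
      calc _ < C ^ 2 * ((P : ℝ) ^ (2 + 2 * δ) * (s : ℝ) ^ (1 + δ) *
            ((m : ℝ) ^ (2 : ℝ) * (m : ℝ) ^ (1 + 3 * δ)) * (n : ℝ) ^ (6 + 6 * δ)) := hsq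
        _ ≤ C ^ 2 * ((P : ℝ) ^ (2 + 2 * δ) * (s : ℝ) ^ (2 : ℝ) *
            ((m : ℝ) ^ (2 : ℝ) * (m : ℝ) ^ (1 + 3 * δ)) * (n : ℝ) ^ (6 + 6 * δ)) := by gcongr
        _ = _ := by ring
    exact lt_of_mul_lt_mul_right (lt_of_mul_lt_mul_left h' hpos1.le) hpos2.le
  -- extract `n`
  have ha : (0 : ℝ) < 2 - 6 * δ := by linarith
  have hn_lt := lt_rpow_mul_rpow_of_rpow_lt hN0.le (by positivity) hM0.le ha hred
  -- compare exponents
  have hexpK : 1 / (2 - 6 * δ) ≤ 1 := by rw [div_le_one ha]; linarith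
  have hexpP : (2 + 2 * δ) / (2 - 6 * δ) ≤ 1 + ε := by rw [div_le_iff₀ ha]; nlinarith
  have hexpY : (1 + 3 * δ) / (2 - 6 * δ) ≤ 1 / 2 + ε := by rw [div_le_iff₀ ha]; nlinarith
  have hC2 : C ^ 2 ≤ max C 1 ^ 2 := by gcongr; exact le_max_left _ _
  have hA : (C ^ 2) ^ (1 / (2 - 6 * δ)) ≤ max C 1 ^ 2 :=
    calc (C ^ 2) ^ (1 / (2 - 6 * δ)) ≤ (max C 1 ^ 2) ^ (1 / (2 - 6 * δ)) := by gcongr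
      _ ≤ (max C 1 ^ 2) ^ (1 : ℝ) := Real.rpow_le_rpow_of_exponent_le (one_le_pow₀ hC1) hexpK
      _ = max C 1 ^ 2 := Real.rpow_one _
  have hB : (P : ℝ) ^ ((2 + 2 * δ) / (2 - 6 * δ)) ≤ (P : ℝ) ^ (1 + ε) :=
    Real.rpow_le_rpow_of_exponent_le hP1 hexpP
  have hD : (m : ℝ) ^ ((1 + 3 * δ) / (2 - 6 * δ)) ≤ (m : ℝ) ^ ((1 : ℝ) / 2 + ε) :=
    Real.rpow_le_rpow_of_exponent_le hM1 hexpY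
  calc (n : ℝ) ≤ (C ^ 2 * (P : ℝ) ^ (2 + 2 * δ)) ^ (1 / (2 - 6 * δ)) *
        (m : ℝ) ^ ((1 + 3 * δ) / (2 - 6 * δ)) := hn_lt.le
    _ = (C ^ 2) ^ (1 / (2 - 6 * δ)) * (P : ℝ) ^ ((2 + 2 * δ) / (2 - 6 * δ)) *
        (m : ℝ) ^ ((1 + 3 * δ) / (2 - 6 * δ)) := by
        rw [Real.mul_rpow (by positivity) (by positivity), ← Real.rpow_mul hPr0.le, mul_one_div]
    _ ≤ max C 1 ^ 2 * (P : ℝ) ^ (1 + ε) * (m : ℝ) ^ ((1 : ℝ) / 2 + ε) :=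
        mul_le_mul (mul_le_mul hA hB (by positivity) (by positivity)) hD (by positivity)
          (by positivity)

/-- Hence **the crux implies `PellSquareCellS`** ("`W₄` with `K` excused places"): under
`UniformSadicTowerFour`, for `1 + t² = s·m·n⁴` with `s` an `S`-unit, `|S| ≤ K`, one has
`n ≤ C(K,ε)·(∏_{p∈S} p)^(1+ε)·m^(1/2+ε)`. (Card §Transfer C⁺.) [folklore] -/
theorem pellSquareCellS_of_uniformSadicTowerFour (hU : UniformSadicTowerFour) :
    ∀ K : ℕ, ∀ ε : ℝ, 0 < ε → ∃ C : ℝ, 0 < C ∧ ∀ S : Finset ℕ, S.card ≤ K →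
      (∀ p ∈ S, Nat.Prime p) → ∀ t s m n : ℕ, 0 < t → 0 < s → 0 < m → 0 < n →
      s.primeFactors ⊆ S → 1 + t ^ 2 = s * m * n ^ 4 →
      (n : ℝ) ≤ C * (((∏ p ∈ S, p) : ℕ) : ℝ) ^ (1 + ε) * (m : ℝ) ^ ((1 : ℝ) / 2 + ε) :=
  pellSquareCellS_of_cellRawS (cellRawS_of_uniformSadicTowerFour hU)

end Summit.ABC.ABC.Theorems.UniformSadicTowerFour.QuarticRootWall
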